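import Literature.Analysis.FluidPDE.RieszPressureLocality
import Literature.Analysis.FluidPDE.NecasRuzickaSverakRiesz
import Literature.Analysis.FluidPDE.NewtonPotentialHolder
import Literature.Analysis.FluidPDE.SteadyNSCaccioppoliTools
import HarnessLib

/-!
# Local `L^{3/2}` growth of the associated pressure of an `L^p` field (Chae–Shvydkoy 2013,
# Lemma 3.3): the near/far splitting of a weak-Poisson pressure

Analysis/FluidPDE proof file (theorems only; no definitions, no named facts, no `sorry`) on the
discharge path of the NAMED FACT `chaeShvydkoy2013_Lp_exclusion` (`SelfSimilarEulerLpExclusion.lean`;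
D. Chae, R. Shvydkoy, *On formation of a locally self-similar collapse in the incompressible Euler
equations*, Arch. Ration. Mech. Anal. **209** (2013) 999–1017 = arXiv:1201.6009 [ChaeShvydkoy2013]).
The bootstrap of the printed proof of Theorem 3.2 (§3.2.1, `p ≥ 9/2`) runs on the pressure-growth
**Lemma 3.3**: "Let `∫_{|y|≤L}|v|² ≤ CL^{a₂}` and `∫_{|y|≤L}|v|³ ≤ CL^{a₃}` hold for all large `L`,
and `a₂ < N`, `(3a₂ − N)/2 ≤ a₃`. Then `∫_{|y|≤L}|q|^{3/2} ≤ CL^{a₃}`", proved by splitting the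
associated pressure `q = q₀ + q̃`, `q̃ = A + B` according to `|z| ≤ 2L` / `|z| ≥ 2L`: "By the standard
boundedness, `A ≤ C∫_{|z|≤2L}|v|³`" and, "given that `|y − z| ∼ |z|`",
`B ≤ L^N (Σ_k (2^{Nk}L^N)^{−1} ∫_{2^kL≤|z|≤2^{k+1}L} |v|²)^{3/2}`.

Here this is rendered for the tree's notion of an *associated pressure of an `L^p` field*
(`P ∈ L^{p/2}(ℝ³)` solving the weak Poisson equation `∫ P Δφ = −∫ D²φ(U,U)`, exactly the
hypothesis of `chaeShvydkoy2013_Lp_exclusion`; CS13 §2.1: "If `v ∈ L^p`, `2 < p < ∞`, and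
`q ∈ L^{p/2}`, then there is only one solution to [the Poisson equation] given by (2.3)") and the
tree's whole-space pressure `Π[w] = rieszPressure w` of an `L³` field (`RieszPressureL3.lean`):

* `ae_abs_sub_rieszPressure_indicator_le` — **the near/far splitting**: for `U ∈ C⁰ ∩ L^p(ℝ³)`,
  `2 < p`, such a `P`, and `L > 0`, for a.e. `x ∈ B_L`,
  `|P(x) − Π[1_{B_{2L}} U](x)| ≤ (4/π) ∫_{|y| ≥ 2L} |U|²/|y|³`.
  Proof (the uniqueness remark of CS13 §2.1 made quantitative, in the manner of
  Robinson–Rodrigo–Sadowski's proof of their Lemma 15.12, `RieszPressureLocality.lean`): for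
  `M > 2L`, `P = Π[1_{B_M}U] + P''_M` a.e. with `P''_M` the `L^{p/2}` pressure of `1_{B_M^c}U`
  (`exists_rieszPressure`; the difference is a weakly harmonic `L^{p/2}` function, and the
  `L^{3/2}`/`L^{p/2}` pressures of the truncated field agree by the two-exponent Weyl–Liouville
  lemma `ae_eq_zero_of_forall_integral_laplacian_mul_inner_eq_zero`); `Π[1_{B_M}U] = Π[1_{B_{2L}}U]
  + Π[1_{B_M∖B_{2L}}U]` (`rieszPressure_add_ae_eq_of_disjoint`), the middle piece being the kernel
  integral `∫ K(x−y)(U y) dy` on `B_L` (`rieszPressure_ae_eq_integral_pressureKernel`) and hence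
  `≤ (4/π)∫_{|y|≥2L}|U|²/|y|³` (`|K(z)a| ≤ |a|²/(2π|z|³)`, `|x − y| ≥ |y|/2`); finally
  `‖P''_M‖_{p/2} ≲ ‖1_{B_M^c}U‖_p² → 0`, so `P''_M → 0` a.e. along a subsequence.
* `exists_setIntegral_abs_rpow_threeHalves_le` — **Lemma 3.3, structural form**: universal
  `A, B ≥ 0` with `∫_{|x|<L} |P|^{3/2} ≤ A ∫_{|y|<2L} |U|³ + B L³ (∫_{|y|≥2L} |U|²/|y|³)^{3/2}` for
  every such `(U, P)` with `3 ≤ p` and every `L > 0` (Stein's `L³ → L^{3/2}` bound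
  `eLpNorm_rieszPressure_le` for the near field; CS13's exponent bookkeeping `a₂, a₃` is left to
  the user: with `∫_{B_R}|U|² ≲ R^{a₂}`, `a₂ < 3`, the far weight is `≲ L^{a₂−3}` by dyadic
  summation, giving `B ≲ L^{(3a₂−3)/2}`).
* `integrableOn_norm_sq_div_norm_cube` — the far weight `|U|²/|y|³` is integrable off balls for
  `U ∈ L^p`, `p > 2` (Hölder).

## Mathlib / tree search

`lean search 'rieszPressure|pressureKernel|Liouville' --decl`: everything needed exists —
`exists_rieszPressure` (`NecasRuzickaSverakRiesz.lean`, general exponent),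
`ae_eq_zero_of_forall_integral_laplacian_mul_inner_eq_zero` (`DivCurlAnnihilator.lean`),
`ae_eq_zero_of_memLp_of_forall_integral_mul_laplacian_eq_zero`, `rieszPressure_add_ae_eq_of_disjoint`,
`rieszPressure_ae_eq_integral_pressureKernel`, `integrable_bilin_apply_self_of_eq_zero_off_compact`,
`integrable_mul_of_eq_zero_off_compact` (`RieszPressureLocality.lean` and imports),
`integral_rieszPressure_mul_laplacian`, `eLpNorm_rieszPressure_le`, `memLp_rieszPressure`
(`RieszPressureL3.lean`), `abs_pressureKernel_le`,
`NewtonPotentialHolder.integrableOn_compl_ball_norm_rpow_neg`, `eLpNorm_three_restrict_eq_ofReal`,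
`eLpNorm_threeHalves_eq_ofReal`, `integrable_abs_rpow_threeHalves`,
`memLp_restrict_of_continuous_isBounded` (`SteadyNSCaccioppoliTools.lean`); Mathlib
`tendstoInMeasure_of_tendsto_eLpNorm`, `TendstoInMeasure.exists_seq_tendsto_ae`,
`memLp_indicator_iff_restrict`, `MemLp.indicator`, `eLpNorm_indicator_eq_eLpNorm_restrict`,
`NNReal.rpow_add_le_mul_rpow_add_rpow`, `tendsto_setIntegral_of_antitone`.
No new definitions, no instances, no notation.
-/

noncomputable section

open MeasureTheory Set Filter Topology Metric
open scoped ENNReal NNReal RealInnerProductSpace Laplacian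

namespace Literature.Analysis.FluidPDE

/-! ## Tools: pairings with test functions, truncations, two-exponent uniqueness -/

/-- `G Δφ` is integrable for `G ∈ L^q`, `1 ≤ q`, and a test function `φ`. [folklore] -/
private theorem integrable_mul_laplacian_of_memLp {q : ℝ≥0∞} (hq : 1 ≤ q)
    {G : EuclideanSpace ℝ (Fin 3) → ℝ} (hG : MemLp G q volume)
    {φ : EuclideanSpace ℝ (Fin 3) → ℝ} (hφ : ContDiff ℝ (⊤ : ℕ∞) φ) (hφc : HasCompactSupport φ) :
    Integrable (fun x => G x * (Δ φ) x) (volume : Measure (EuclideanSpace ℝ (Fin 3))) := by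
  have hφ2 : ContDiff ℝ 2 φ := contDiff_infty.1 hφ 2
  have hΔc : Continuous (Δ φ) := continuous_laplacian hφ2
  have hΔ0 : ∀ x ∉ tsupport φ, Δ φ x = 0 := fun x hx => laplacian_eq_zero_of_notMem_tsupport hx
  have hGi : IntegrableOn G (tsupport φ) volume :=
    (hG.locallyIntegrable hq).integrableOn_isCompact hφc
  have h1 := integrable_mul_of_eq_zero_off_compact hφc hΔc hΔ0 hGi
  simpa only [mul_comm] using h1

-- nested operator types
set_option maxSynthPendingDepth 3 in
/-- The Hessian quadratic form of a test function paired with an `L^p` field, `p ≥ 2`, is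
integrable. [folklore] -/
private theorem integrable_hessian_apply_of_memLp_ofReal {p : ℝ} (hp : 2 ≤ p)
    {U : EuclideanSpace ℝ (Fin 3) → EuclideanSpace ℝ (Fin 3)} (hU : MemLp U (ENNReal.ofReal p) volume)
    {φ : EuclideanSpace ℝ (Fin 3) → ℝ} (hφ : ContDiff ℝ (⊤ : ℕ∞) φ) (hφc : HasCompactSupport φ) :
    Integrable (fun x => fderiv ℝ (fderiv ℝ φ) x (U x) (U x))
      (volume : Measure (EuclideanSpace ℝ (Fin 3))) := by
  have hφ2 : ContDiff ℝ 2 φ := contDiff_infty.1 hφ 2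
  have hHc : Continuous (fderiv ℝ (fderiv ℝ φ)) :=
    (hφ2.fderiv_right (m := 1) (by norm_num)).continuous_fderiv one_ne_zero
  have hH0 : ∀ x ∉ tsupport φ, fderiv ℝ (fderiv ℝ φ) x = 0 := fun x hx =>
    fderiv_fderiv_eq_zero_of_notMem_tsupport hx
  haveI : IsFiniteMeasure (volume.restrict (tsupport φ)) :=
    ⟨by rw [Measure.restrict_apply_univ]; exact hφc.measure_lt_top⟩
  have hU2 : MemLp U 2 (volume.restrict (tsupport φ)) :=
    (hU.restrict (tsupport φ)).mono_exponent (by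
      rw [show (2 : ℝ≥0∞) = ENNReal.ofReal 2 by norm_num]
      exact ENNReal.ofReal_le_ofReal hp)
  have hU2i : IntegrableOn (fun x => ‖U x‖ ^ 2) (tsupport φ) volume :=
    (memLp_two_iff_integrable_sq_norm hU2.1).1 hU2
  exact integrable_bilin_apply_self_of_eq_zero_off_compact hφc hHc hH0
    (hU.1.mono_measure Measure.restrict_le_self) hU2i

/-- **Two-exponent uniqueness for the weak Poisson equation.** If `Q₁ ∈ L^{q₁}` and `Q₂ ∈ L^{q₂}`
(`1 < qᵢ < ∞`) have the same weak Laplacian against test functions, then `Q₁ = Q₂` a.e. (the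
difference `Q₁ e₀ + (−Q₂ e₀)` is weakly harmonic in `L^{q₁} + L^{q₂}`: the tree's two-exponent
Weyl–Liouville lemma). [folklore] -/
private theorem ae_eq_of_weakLaplacian_eq {q₁ q₂ : ℝ≥0∞} (h₁ : 1 < q₁) (h₁' : q₁ < ⊤)
    (h₂ : 1 < q₂) (h₂' : q₂ < ⊤) {Q₁ Q₂ : EuclideanSpace ℝ (Fin 3) → ℝ}
    (hQ₁ : MemLp Q₁ q₁ volume) (hQ₂ : MemLp Q₂ q₂ volume) {S : (EuclideanSpace ℝ (Fin 3) → ℝ) → ℝ}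
    (hP₁ : ∀ φ : EuclideanSpace ℝ (Fin 3) → ℝ, ContDiff ℝ (⊤ : ℕ∞) φ → HasCompactSupport φ →
      ∫ x, Q₁ x * (Δ φ) x = S φ)
    (hP₂ : ∀ φ : EuclideanSpace ℝ (Fin 3) → ℝ, ContDiff ℝ (⊤ : ℕ∞) φ → HasCompactSupport φ →
      ∫ x, Q₂ x * (Δ φ) x = S φ) :
    Q₁ =ᵐ[volume] Q₂ := by
  obtain ⟨e₀, he₀0⟩ := exists_ne (0 : EuclideanSpace ℝ (Fin 3))
  set w₁ : EuclideanSpace ℝ (Fin 3) → EuclideanSpace ℝ (Fin 3) := fun x => Q₁ x • e₀ with hw₁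
  set w₂ : EuclideanSpace ℝ (Fin 3) → EuclideanSpace ℝ (Fin 3) := fun x => -(Q₂ x • e₀) with hw₂
  have hsmul : ∀ {q : ℝ≥0∞} {Q : EuclideanSpace ℝ (Fin 3) → ℝ}, MemLp Q q volume →
      MemLp (fun x => Q x • e₀) q volume := by
    intro q Q hQ
    refine MemLp.of_le (hQ.norm.const_mul ‖e₀‖) (hQ.1.smul_const e₀)
      (Eventually.of_forall fun x => ?_)
    simp only [norm_smul, Real.norm_eq_abs, abs_mul, abs_norm, abs_abs, mul_comm]
    exact le_rfl
  have hw₁Lp : MemLp w₁ q₁ volume := hsmul hQ₁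
  have hw₂Lp : MemLp w₂ q₂ volume := (hsmul hQ₂).neg
  have key : ∀ θ : EuclideanSpace ℝ (Fin 3) → ℝ,
      FunctionSpaces.IsTestFunctionOn (⊤ : TopologicalSpace.Opens (EuclideanSpace ℝ (Fin 3))) θ →
      ∀ a : EuclideanSpace ℝ (Fin 3), ∫ x, (Δ θ) x * ⟪(w₁ + w₂) x, a⟫ = 0 := by
    intro θ hθ a
    have e : (fun x => (Δ θ) x * ⟪(w₁ + w₂) x, a⟫) =
        fun x => ⟪e₀, a⟫ * (Q₁ x * (Δ θ) x) - ⟪e₀, a⟫ * (Q₂ x * (Δ θ) x) := by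
      funext x
      simp only [hw₁, hw₂, Pi.add_apply, inner_add_left, inner_neg_left, inner_smul_left,
        RCLike.conj_to_real]
      ring
    rw [e, integral_sub ((integrable_mul_laplacian_of_memLp h₁.le hQ₁ hθ.contDiff
        hθ.hasCompactSupport).const_mul _) ((integrable_mul_laplacian_of_memLp h₂.le hQ₂
        hθ.contDiff hθ.hasCompactSupport).const_mul _), integral_const_mul, integral_const_mul,
      hP₁ θ hθ.contDiff hθ.hasCompactSupport, hP₂ θ hθ.contDiff hθ.hasCompactSupport, sub_self]
  have h := ae_eq_zero_of_forall_integral_laplacian_mul_inner_eq_zero h₁ h₁' h₂ h₂' hw₁Lp hw₂Lp key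
  filter_upwards [h] with x hx
  have hx' : (Q₁ x - Q₂ x) • e₀ = 0 := by
    have : Q₁ x • e₀ + -(Q₂ x • e₀) = 0 := by simpa [hw₁, hw₂] using hx
    rw [sub_smul]
    simpa [sub_eq_add_neg] using this
  rcases smul_eq_zero.1 hx' with h0 | h0
  · linarith
  · exact absurd h0 he₀0

/-- A continuous field truncated to a bounded measurable set is in every `L^r(ℝ³)`. [folklore] -/
private theorem memLp_setIndicator_of_continuous_isBounded
    {U : EuclideanSpace ℝ (Fin 3) → EuclideanSpace ℝ (Fin 3)} (hU : Continuous U)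
    {S : Set (EuclideanSpace ℝ (Fin 3))} (hS : MeasurableSet S)
    (hSb : Bornology.IsBounded S) (r : ℝ≥0∞) : MemLp (S.indicator U) r volume :=
  (memLp_indicator_iff_restrict hS).2 (memLp_restrict_of_continuous_isBounded hU hSb r)

/-- **The far weight is integrable.** For `U ∈ L^p(ℝ³)`, `p > 2`, and `r > 0`, `|U|²/|y|³` is
integrable on `{|y| ≥ r}` (Hölder: `|U|² ∈ L^{p/2}`, `|y|^{−3} ∈ L^{p/(p−2)}(|y| ≥ r)`).
[cite: ChaeShvydkoy2013, §3.2.1 (proof of Lemma 3.3, estimate of B)] -/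
theorem integrableOn_norm_sq_div_norm_cube {p : ℝ} (hp : 2 < p)
    {U : EuclideanSpace ℝ (Fin 3) → EuclideanSpace ℝ (Fin 3)} (hU : MemLp U (ENNReal.ofReal p) volume)
    {r : ℝ} (hr : 0 < r) :
    IntegrableOn (fun y => ‖U y‖ ^ 2 / ‖y‖ ^ 3) (ball (0 : EuclideanSpace ℝ (Fin 3)) r)ᶜ volume := by
  have hp0 : 0 < p := by linarith
  have hp2 : 0 < p - 2 := by linarith
  set s : ℝ := p / (p - 2) with hs
  have hs1 : 1 < s := by rw [hs, lt_div_iff₀ hp2]; linarith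
  have hs0 : 0 < s := by linarith
  have h3s : 3 < 3 * s := by linarith
  set μ : Measure (EuclideanSpace ℝ (Fin 3)) :=
    volume.restrict (ball (0 : EuclideanSpace ℝ (Fin 3)) r)ᶜ with hμ
  -- the weight `|y|^{-3}` in `L^s` of the complement
  have hw : MemLp (fun y : EuclideanSpace ℝ (Fin 3) => ‖y‖ ^ (-(3 : ℝ))) (ENNReal.ofReal s) μ := by
    have hmeas : AEStronglyMeasurable (fun y : EuclideanSpace ℝ (Fin 3) => ‖y‖ ^ (-(3 : ℝ))) μ :=
      (measurable_norm.pow_const _).aestronglyMeasurable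
    rw [← integrable_norm_rpow_iff hmeas (by simp [hs0]) ENNReal.ofReal_ne_top,
      ENNReal.toReal_ofReal hs0.le]
    have hint : IntegrableOn (fun y : EuclideanSpace ℝ (Fin 3) => ‖y‖ ^ (-(3 * s)))
        (ball (0 : EuclideanSpace ℝ (Fin 3)) r)ᶜ volume :=
      NewtonPotentialHolder.integrableOn_compl_ball_norm_rpow_neg h3s hr
    have hpt : ∀ y : EuclideanSpace ℝ (Fin 3), (‖y‖ ^ (-(3 : ℝ))) ^ s = ‖y‖ ^ (-(3 * s)) := by
      intro y
      rw [← Real.rpow_mul (norm_nonneg _)]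
      ring_nf
    refine (hint.congr_fun (g := fun y : EuclideanSpace ℝ (Fin 3) => (‖y‖ ^ (-(3 : ℝ))) ^ s)
      (fun y _ => (hpt y).symm) measurableSet_ball.compl).congr (Eventually.of_forall fun y => ?_)
    simp only [Real.norm_eq_abs, abs_of_nonneg (Real.rpow_nonneg (norm_nonneg y) _)]
  -- `|U|²` in `L^{p/2}`
  have hU2 : MemLp (fun y => ‖U y‖ ^ 2) (ENNReal.ofReal (p / 2)) μ := by
    have h := (hU.restrict (ball (0 : EuclideanSpace ℝ (Fin 3)) r)ᶜ).norm_rpow_div (2 : ℝ≥0∞)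
    have e2 : ENNReal.ofReal p / 2 = ENNReal.ofReal (p / 2) := by
      rw [ENNReal.ofReal_div_of_pos two_pos]
      norm_num
    rw [e2] at h
    refine h.congr_norm ((hU.1.mono_measure Measure.restrict_le_self).norm.aemeasurable.pow_const
      _).aestronglyMeasurable (Eventually.of_forall fun y => ?_)
    simp only [ENNReal.toReal_ofNat, Real.norm_eq_abs]
    rw [show (2 : ℝ) = ((2 : ℕ) : ℝ) by norm_num, Real.rpow_natCast]
  haveI : ENNReal.HolderTriple (ENNReal.ofReal s) (ENNReal.ofReal (p / 2)) 1 := by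
    constructor
    rw [← ENNReal.ofReal_inv_of_pos hs0, ← ENNReal.ofReal_inv_of_pos (by positivity),
      ← ENNReal.ofReal_add (by positivity) (by positivity), inv_one, ← ENNReal.ofReal_one]
    congr 1
    rw [hs, inv_div, inv_div]
    field_simp
    ring
  have h : MemLp (fun y : EuclideanSpace ℝ (Fin 3) => ‖y‖ ^ (-(3 : ℝ)) * ‖U y‖ ^ 2) 1 μ :=
    MemLp.mul' hU2 hw
  have h1 : Integrable (fun y : EuclideanSpace ℝ (Fin 3) => ‖y‖ ^ (-(3 : ℝ)) * ‖U y‖ ^ 2) μ :=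
    memLp_one_iff_integrable.1 h
  refine h1.congr (Eventually.of_forall fun y => ?_)
  simp only
  rw [Real.rpow_neg (norm_nonneg _), show (3 : ℝ) = ((3 : ℕ) : ℝ) by norm_num, Real.rpow_natCast]
  ring

/-! ## The near/far splitting of a weak-Poisson pressure -/

/-- The kernel bound on the far annulus: for `|x| < L`, `|y| ≥ 2L`,
`|K(x − y) a| ≤ (4/π) |a|²/|y|³` (`|x − y| ≥ |y|/2`). [folklore] -/
private theorem abs_pressureKernel_far_le {L : ℝ} (hL : 0 < L) {x y : EuclideanSpace ℝ (Fin 3)}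
    (hx : x ∈ ball (0 : EuclideanSpace ℝ (Fin 3)) L)
    (hy : y ∈ (ball (0 : EuclideanSpace ℝ (Fin 3)) (2 * L))ᶜ) (a : EuclideanSpace ℝ (Fin 3)) :
    |pressureKernel (x - y) a| ≤ 4 / Real.pi * (‖a‖ ^ 2 / ‖y‖ ^ 3) := by
  rw [mem_ball_zero_iff] at hx
  rw [mem_compl_iff, mem_ball_zero_iff, not_lt] at hy
  have hy0 : 0 < ‖y‖ := by linarith
  have hxy : ‖y‖ / 2 ≤ ‖x - y‖ := by
    have h1 : ‖y‖ ≤ ‖x - y‖ + ‖x‖ := by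
      calc ‖y‖ = ‖x - (x - y)‖ := by rw [sub_sub_cancel]
        _ ≤ ‖x‖ + ‖x - y‖ := norm_sub_le _ _
        _ = ‖x - y‖ + ‖x‖ := add_comm _ _
    linarith
  have hxy0 : 0 < ‖x - y‖ := lt_of_lt_of_le (by positivity) hxy
  have h3 : ‖y‖ ^ 3 / 8 ≤ ‖x - y‖ ^ 3 := by
    have := pow_le_pow_left₀ (by positivity) hxy 3
    calc ‖y‖ ^ 3 / 8 = (‖y‖ / 2) ^ 3 := by ring
      _ ≤ ‖x - y‖ ^ 3 := this
  calc |pressureKernel (x - y) a| ≤ ‖a‖ ^ 2 / (2 * Real.pi * ‖x - y‖ ^ 3) := abs_pressureKernel_le _ _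
    _ ≤ ‖a‖ ^ 2 / (2 * Real.pi * (‖y‖ ^ 3 / 8)) := by
        gcongr
    _ = 4 / Real.pi * (‖a‖ ^ 2 / ‖y‖ ^ 3) := by
        field_simp
        ring

-- nested operator types
set_option maxSynthPendingDepth 3 in
/-- **The near/far splitting of an associated pressure** (the uniqueness remark of CS13 §2.1,
"If `v ∈ L^p`, `2 < p < ∞` … and `q ∈ L^{p/2}` …, then there is only one solution to [`Δq =
−∂ᵢ∂ⱼ(vᵢvⱼ)`] given by (2.3)", made quantitative as in the proof of Lemma 3.3: "`A`" = the
Calderón–Zygmund pressure of `1_{|z|≤2L} v`, "`B`" = the far kernel integral with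
"`|y − z| ∼ |z|`"). Let `U ∈ C⁰ ∩ L^p(ℝ³)`, `p > 2`, and let `P ∈ L^{p/2}(ℝ³)` solve the weak
Poisson equation `∫ P Δφ = −∫ D²φ(U, U)` for all test functions `φ`. Then for every `L > 0` and
a.e. `x ∈ B_L`,
`|P(x) − Π[1_{B_{2L}} U](x)| ≤ (4/π) ∫_{|y| ≥ 2L} |U(y)|²/|y|³ dy`,
where `Π` is the tree's Riesz pressure of the (bounded, compactly supported) near field.
Proof: see the module docstring. [cite: ChaeShvydkoy2013, §3.2.1 Lemma 3.3 (proof: q̃ = A + B)] -/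
theorem ae_abs_sub_rieszPressure_indicator_le {p : ℝ} (hp : 2 < p)
    {U : EuclideanSpace ℝ (Fin 3) → EuclideanSpace ℝ (Fin 3)} {P : EuclideanSpace ℝ (Fin 3) → ℝ}
    (hUc : Continuous U) (hU : MemLp U (ENNReal.ofReal p) volume)
    (hP : MemLp P (ENNReal.ofReal (p / 2)) volume)
    (hPoisson : ∀ φ : EuclideanSpace ℝ (Fin 3) → ℝ, ContDiff ℝ (⊤ : ℕ∞) φ → HasCompactSupport φ →
      ∫ x, P x * (Δ φ) x = -∫ x, fderiv ℝ (fderiv ℝ φ) x (U x) (U x))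
    {L : ℝ} (hL : 0 < L) :
    ∀ᵐ x ∂(volume.restrict (ball (0 : EuclideanSpace ℝ (Fin 3)) L)),
      |P x - rieszPressure ((ball (0 : EuclideanSpace ℝ (Fin 3)) (2 * L)).indicator U) x| ≤
        4 / Real.pi * ∫ y in (ball (0 : EuclideanSpace ℝ (Fin 3)) (2 * L))ᶜ, ‖U y‖ ^ 2 / ‖y‖ ^ 3 := by
  -- exponents
  have hp0 : 0 < p := by linarith
  have hq1 : (1 : ℝ≥0∞) < ENNReal.ofReal (p / 2) := by
    rw [← ENNReal.ofReal_one]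
    exact (ENNReal.ofReal_lt_ofReal_iff (by positivity)).2 (by linarith)
  have hqtop : ENNReal.ofReal (p / 2) < ⊤ := ENNReal.ofReal_lt_top
  have h32_1 : (1 : ℝ≥0∞) < 3 / 2 :=
    (ENNReal.lt_div_iff_mul_lt (Or.inl (by norm_num)) (Or.inl (by norm_num))).2 (by norm_num)
  have h32_top : (3 / 2 : ℝ≥0∞) < ⊤ := ENNReal.div_lt_top ENNReal.ofNat_ne_top two_ne_zero
  have hconv : ENNReal.ofReal (p / 2) * 2 = ENNReal.ofReal p := by
    rw [show (2 : ℝ≥0∞) = ENNReal.ofReal 2 by norm_num, ← ENNReal.ofReal_mul (by positivity)]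
    congr 1
    ring
  obtain ⟨Cq, hCq⟩ := exists_rieszPressure (q := p / 2) (by linarith)
  -- sets, truncations
  set B₂ : Set (EuclideanSpace ℝ (Fin 3)) := ball (0 : EuclideanSpace ℝ (Fin 3)) (2 * L) with hB₂
  set U₁ : EuclideanSpace ℝ (Fin 3) → EuclideanSpace ℝ (Fin 3) := B₂.indicator U with hU₁
  set W : ℝ := ∫ y in B₂ᶜ, ‖U y‖ ^ 2 / ‖y‖ ^ 3 with hW
  have hWi : IntegrableOn (fun y => ‖U y‖ ^ 2 / ‖y‖ ^ 3) B₂ᶜ volume :=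
    integrableOn_norm_sq_div_norm_cube hp hU (by linarith)
  have hW0 : 0 ≤ W := integral_nonneg fun y => by positivity
  set M : ℕ → ℝ := fun n => 2 * L + (n + 1) with hM
  have hM2 : ∀ n, 2 * L < M n := fun n => by
    simp only [hM]
    linarith [n.cast_nonneg (α := ℝ)]
  have hM0 : ∀ n, 0 < M n := fun n => by linarith [hM2 n]
  set Uin : ℕ → EuclideanSpace ℝ (Fin 3) → EuclideanSpace ℝ (Fin 3) :=
    fun n => (ball (0 : EuclideanSpace ℝ (Fin 3)) (M n)).indicator U with hUin
  set Umid : ℕ → EuclideanSpace ℝ (Fin 3) → EuclideanSpace ℝ (Fin 3) :=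
    fun n => (B₂ᶜ ∩ ball (0 : EuclideanSpace ℝ (Fin 3)) (M n)).indicator U with hUmid
  set Uout : ℕ → EuclideanSpace ℝ (Fin 3) → EuclideanSpace ℝ (Fin 3) :=
    fun n => (ball (0 : EuclideanSpace ℝ (Fin 3)) (M n))ᶜ.indicator U with hUout
  have hmidS : ∀ n, MeasurableSet (B₂ᶜ ∩ ball (0 : EuclideanSpace ℝ (Fin 3)) (M n)) := fun n =>
    measurableSet_ball.compl.inter measurableSet_ball
  -- memberships
  have hU₁3 : MemLp U₁ 3 volume :=
    memLp_setIndicator_of_continuous_isBounded hUc measurableSet_ball isBounded_ball 3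
  have hUin3 : ∀ n, MemLp (Uin n) 3 volume := fun n =>
    memLp_setIndicator_of_continuous_isBounded hUc measurableSet_ball isBounded_ball 3
  have hUinp : ∀ n, MemLp (Uin n) (ENNReal.ofReal (p / 2) * 2) volume := fun n => by
    rw [hconv]
    exact memLp_setIndicator_of_continuous_isBounded hUc measurableSet_ball isBounded_ball _
  have hUmid3 : ∀ n, MemLp (Umid n) 3 volume := fun n =>
    memLp_setIndicator_of_continuous_isBounded hUc (hmidS n)
      (isBounded_ball.subset inter_subset_right) 3
  have hUoutp : ∀ n, MemLp (Uout n) (ENNReal.ofReal (p / 2) * 2) volume := fun n => by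
    rw [hconv]
    exact hU.indicator measurableSet_ball.compl
  -- (a) additivity of the Riesz pressure: `Π[Uin n] = Π[U₁] + Π[Umid n]`
  have ha : ∀ n, rieszPressure (Uin n) =ᵐ[volume]
      fun x => rieszPressure U₁ x + rieszPressure (Umid n) x := by
    intro n
    refine rieszPressure_add_ae_eq_of_disjoint (hUin3 n) hU₁3 (hUmid3 n) (fun y => ?_)
      (ae_of_all _ fun y => ?_)
    · by_cases hy : y ∈ B₂
      · right
        simp only [hUmid]
        exact indicator_of_notMem (fun h => h.1 hy) _
      · left
        simp only [hU₁]
        exact indicator_of_notMem hy _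
    · simp only [hUin, hU₁, hUmid, Pi.add_apply]
      by_cases hy : y ∈ B₂
      · have hyM : y ∈ ball (0 : EuclideanSpace ℝ (Fin 3)) (M n) := by
          rw [mem_ball_zero_iff] at hy ⊢
          linarith [hM2 n]
        rw [indicator_of_mem hyM, indicator_of_mem hy, indicator_of_notMem (fun h => h.1 hy),
          add_zero]
      · rw [indicator_of_notMem hy, zero_add]
        by_cases hyM : y ∈ ball (0 : EuclideanSpace ℝ (Fin 3)) (M n)
        · rw [indicator_of_mem hyM, indicator_of_mem (show y ∈ B₂ᶜ ∩ _ from ⟨hy, hyM⟩)]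
        · rw [indicator_of_notMem hyM, indicator_of_notMem (fun h => hyM h.2)]
  -- (b) kernel representation of the middle piece on `B_L`
  have hb : ∀ n, ∀ᵐ x ∂(volume.restrict (ball (0 : EuclideanSpace ℝ (Fin 3)) L)),
      rieszPressure (Umid n) x = ∫ y, pressureKernel (x - y) (Umid n y) := by
    intro n
    refine rieszPressure_ae_eq_integral_pressureKernel (a := 0) (R := 2 * L) (R₁ := M n)
      (hUmid3 n) hL (by linarith) (fun y hy => ?_) (fun y hy => ?_)
    · simp only [hUmid]
      exact indicator_of_notMem (fun h => h.1 hy) _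
    · simp only [hUmid]
      refine indicator_of_notMem (fun h => hy ?_) _
      exact ball_subset_closedBall h.2
  -- (c) the far kernel integral is bounded by `(4/π) W` on `B_L`
  have hc : ∀ n, ∀ x ∈ ball (0 : EuclideanSpace ℝ (Fin 3)) L,
      |∫ y, pressureKernel (x - y) (Umid n y)| ≤ 4 / Real.pi * W := by
    intro n x hx
    have hbound : ∀ y, ‖pressureKernel (x - y) (Umid n y)‖ ≤
        4 / Real.pi * B₂ᶜ.indicator (fun y => ‖U y‖ ^ 2 / ‖y‖ ^ 3) y := by
      intro y
      rw [Real.norm_eq_abs]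
      by_cases hy : y ∈ B₂ᶜ ∩ ball (0 : EuclideanSpace ℝ (Fin 3)) (M n)
      · simp only [hUmid]
        rw [indicator_of_mem hy, indicator_of_mem hy.1]
        exact abs_pressureKernel_far_le hL hx hy.1 (U y)
      · simp only [hUmid]
        rw [indicator_of_notMem hy, pressureKernel_zero_right, abs_zero]
        have : 0 ≤ B₂ᶜ.indicator (fun y => ‖U y‖ ^ 2 / ‖y‖ ^ 3) y :=
          indicator_nonneg (fun z _ => by positivity) _
        positivity
    have hgi : Integrable (fun y => 4 / Real.pi * B₂ᶜ.indicator (fun y => ‖U y‖ ^ 2 / ‖y‖ ^ 3) y)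
        (volume : Measure (EuclideanSpace ℝ (Fin 3))) :=
      (hWi.integrable_indicator measurableSet_ball.compl).const_mul _
    have h1 := norm_integral_le_of_norm_le hgi (Eventually.of_forall hbound)
    rw [integral_const_mul, integral_indicator measurableSet_ball.compl] at h1
    rwa [Real.norm_eq_abs] at h1
  -- (d) the `L^{p/2}` pressures of the truncations
  have hexQ : ∀ n, ∃ Q : EuclideanSpace ℝ (Fin 3) → ℝ, MemLp Q (ENNReal.ofReal (p / 2)) volume ∧
      ∀ φ : EuclideanSpace ℝ (Fin 3) → ℝ, ContDiff ℝ (⊤ : ℕ∞) φ → HasCompactSupport φ →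
        ∫ y, Q y * (Δ φ) y = -∫ y, fderiv ℝ (fderiv ℝ φ) y (Uin n y) (Uin n y) := by
    intro n
    obtain ⟨Q, hQ1, -, hQ3⟩ := hCq (Uin n) (hUinp n)
    exact ⟨Q, hQ1, hQ3⟩
  choose Q hQmem hQeq using hexQ
  have hexR : ∀ n, ∃ R : EuclideanSpace ℝ (Fin 3) → ℝ, MemLp R (ENNReal.ofReal (p / 2)) volume ∧
      eLpNorm R (ENNReal.ofReal (p / 2)) volume ≤
        ↑Cq * eLpNorm (Uout n) (ENNReal.ofReal (p / 2) * 2) volume ^ 2 ∧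
      ∀ φ : EuclideanSpace ℝ (Fin 3) → ℝ, ContDiff ℝ (⊤ : ℕ∞) φ → HasCompactSupport φ →
        ∫ y, R y * (Δ φ) y = -∫ y, fderiv ℝ (fderiv ℝ φ) y (Uout n y) (Uout n y) :=
    fun n => hCq (Uout n) (hUoutp n)
  choose R hRmem hRnorm hReq using hexR
  -- (d1) `Q n = Π[Uin n]` a.e. (two-exponent uniqueness)
  have hd1 : ∀ n, Q n =ᵐ[volume] rieszPressure (Uin n) := fun n =>
    ae_eq_of_weakLaplacian_eq hq1 hqtop h32_1 h32_top (hQmem n) (memLp_rieszPressure (hUin3 n))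
      (S := fun φ => -∫ y, fderiv ℝ (fderiv ℝ φ) y (Uin n y) (Uin n y)) (hQeq n)
      (fun φ hφ hφc => integral_rieszPressure_mul_laplacian (hUin3 n) hφ hφc)
  -- (d2) `P = Q n + R n` a.e. (the difference is weakly harmonic in `L^{p/2}`)
  have hUp : MemLp U (ENNReal.ofReal p) volume := hU
  have hUinp' : ∀ n, MemLp (Uin n) (ENNReal.ofReal p) volume := fun n => by
    rw [← hconv]; exact hUinp n
  have hUoutp' : ∀ n, MemLp (Uout n) (ENNReal.ofReal p) volume := fun n => by
    rw [← hconv]; exact hUoutp n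
  have hd2 : ∀ n, P =ᵐ[volume] fun x => Q n x + R n x := by
    intro n
    have hdiff : MemLp (fun x => P x - Q n x - R n x) (ENNReal.ofReal (p / 2)) volume :=
      (hP.sub (hQmem n)).sub (hRmem n)
    have hharm : ∀ φ : EuclideanSpace ℝ (Fin 3) → ℝ, ContDiff ℝ (⊤ : ℕ∞) φ → HasCompactSupport φ →
        ∫ x, (P x - Q n x - R n x) * (Δ φ) x = 0 := by
      intro φ hφ hφc
      have iP := integrable_mul_laplacian_of_memLp hq1.le hP hφ hφc
      have iQ := integrable_mul_laplacian_of_memLp hq1.le (hQmem n) hφ hφc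
      have iR := integrable_mul_laplacian_of_memLp hq1.le (hRmem n) hφ hφc
      have e : (fun x => (P x - Q n x - R n x) * (Δ φ) x) =
          fun x => (P x * (Δ φ) x - Q n x * (Δ φ) x) - R n x * (Δ φ) x := by
        funext x; ring
      have iPQ : Integrable (fun x => P x * (Δ φ) x - Q n x * (Δ φ) x)
          (volume : Measure (EuclideanSpace ℝ (Fin 3))) := iP.sub iQ
      rw [e, integral_sub iPQ iR, integral_sub iP iQ, hPoisson φ hφ hφc, hQeq n φ hφ hφc,
        hReq n φ hφ hφc]
      -- the tensor splits pointwise: `D²φ(U,U) = D²φ(Uin,Uin) + D²φ(Uout,Uout)`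
      have hsplit : ∫ x, fderiv ℝ (fderiv ℝ φ) x (U x) (U x) =
          (∫ x, fderiv ℝ (fderiv ℝ φ) x (Uin n x) (Uin n x)) +
            ∫ x, fderiv ℝ (fderiv ℝ φ) x (Uout n x) (Uout n x) := by
        rw [← integral_add (integrable_hessian_apply_of_memLp_ofReal hp.le (hUinp' n) hφ hφc)
          (integrable_hessian_apply_of_memLp_ofReal hp.le (hUoutp' n) hφ hφc)]
        refine integral_congr_ae (ae_of_all _ fun x => ?_)
        simp only [hUin, hUout]
        by_cases hx : x ∈ ball (0 : EuclideanSpace ℝ (Fin 3)) (M n)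
        · rw [indicator_of_mem hx, indicator_of_notMem (show x ∉ (ball (0 : EuclideanSpace ℝ
            (Fin 3)) (M n))ᶜ from fun h => h hx)]
          simp
        · rw [indicator_of_notMem hx, indicator_of_mem (mem_compl hx)]
          simp
      rw [hsplit]
      ring
    have h0 := ae_eq_zero_of_memLp_of_forall_integral_mul_laplacian_eq_zero hq1 hqtop hdiff hharm
    filter_upwards [h0] with x hx
    simp only [Pi.zero_apply] at hx
    linarith
  -- (e) `R n → 0` in `L^{p/2}`, hence a.e. along a subsequence
  have hT : Tendsto (fun n => ∫ y in (ball (0 : EuclideanSpace ℝ (Fin 3)) (M n))ᶜ, ‖U y‖ ^ p)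
      atTop (𝓝 0) := by
    have hUpi : Integrable (fun y => ‖U y‖ ^ p) (volume : Measure (EuclideanSpace ℝ (Fin 3))) := by
      have h := hU.integrable_norm_rpow (by simp [hp0]) ENNReal.ofReal_ne_top
      rwa [ENNReal.toReal_ofReal hp0.le] at h
    have hmeas : ∀ n, MeasurableSet (ball (0 : EuclideanSpace ℝ (Fin 3)) (M n))ᶜ := fun n =>
      measurableSet_ball.compl
    have hanti : Antitone fun n => (ball (0 : EuclideanSpace ℝ (Fin 3)) (M n))ᶜ := by
      intro m n hmn
      refine compl_subset_compl.2 (ball_subset_ball ?_)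
      simp only [hM]
      have : (m : ℝ) ≤ n := Nat.cast_le.2 hmn
      linarith
    have h := tendsto_setIntegral_of_antitone (μ := volume) (f := fun y => ‖U y‖ ^ p) hmeas hanti
      ⟨0, hUpi.integrableOn⟩
    have hempty : (⋂ n, (ball (0 : EuclideanSpace ℝ (Fin 3)) (M n))ᶜ) = ∅ := by
      ext y
      simp only [mem_iInter, mem_compl_iff, mem_ball_zero_iff, not_lt, mem_empty_iff_false,
        iff_false, not_forall, not_le]
      obtain ⟨n, hn⟩ := exists_nat_gt (‖y‖ - 2 * L - 1)
      refine ⟨n, ?_⟩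
      simp only [hM]
      linarith
    rwa [hempty, Measure.restrict_empty, integral_zero_measure] at h
  have hRto : Tendsto (fun n => eLpNorm (R n - 0) (ENNReal.ofReal (p / 2)) volume) atTop (𝓝 0) := by
    simp only [sub_zero]
    -- `eLpNorm (Uout n) p = ofReal ((∫_{|y| ≥ M n} |U|^p)^{1/p})`
    have hnorm : ∀ n, eLpNorm (Uout n) (ENNReal.ofReal p) volume =
        ENNReal.ofReal ((∫ y in (ball (0 : EuclideanSpace ℝ (Fin 3)) (M n))ᶜ, ‖U y‖ ^ p) ^ p⁻¹) := by
      intro n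
      simp only [hUout]
      rw [eLpNorm_indicator_eq_eLpNorm_restrict measurableSet_ball.compl,
        (hU.restrict _).eLpNorm_eq_integral_rpow_norm (by simp [hp0]) ENNReal.ofReal_ne_top,
        ENNReal.toReal_ofReal hp0.le]
    have hbd : ∀ n, eLpNorm (R n) (ENNReal.ofReal (p / 2)) volume ≤
        ↑Cq * ENNReal.ofReal (((∫ y in (ball (0 : EuclideanSpace ℝ (Fin 3)) (M n))ᶜ, ‖U y‖ ^ p) ^
          p⁻¹) ^ 2) := by
      intro n
      have h := hRnorm n
      rw [hconv, hnorm n, ← ENNReal.ofReal_pow (Real.rpow_nonneg (integral_nonneg fun y => by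
        positivity) _)] at h
      exact h
    have hlim : Tendsto (fun n => (↑Cq : ℝ≥0∞) * ENNReal.ofReal
        (((∫ y in (ball (0 : EuclideanSpace ℝ (Fin 3)) (M n))ᶜ, ‖U y‖ ^ p) ^ p⁻¹) ^ 2))
        atTop (𝓝 0) := by
      have h1 : Tendsto (fun n => ((∫ y in (ball (0 : EuclideanSpace ℝ (Fin 3)) (M n))ᶜ,
          ‖U y‖ ^ p) ^ p⁻¹) ^ 2) atTop (𝓝 0) := by
        have := (hT.rpow_const (p := p⁻¹) (Or.inr (by positivity))).pow 2
        rwa [Real.zero_rpow (by positivity), zero_pow two_ne_zero] at this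
      have h2 := ENNReal.tendsto_ofReal h1
      rw [ENNReal.ofReal_zero] at h2
      have h3 := ENNReal.Tendsto.const_mul (a := (↑Cq : ℝ≥0∞)) h2 (Or.inr ENNReal.coe_ne_top)
      rwa [mul_zero] at h3
    exact tendsto_of_tendsto_of_tendsto_of_le_of_le tendsto_const_nhds hlim (fun _ => bot_le) hbd
  have hRmeas : TendstoInMeasure volume R atTop (fun _ => (0 : ℝ)) :=
    tendstoInMeasure_of_tendsto_eLpNorm (by
      intro h0
      rw [h0] at hq1
      exact absurd hq1 (by norm_num)) (fun n => (hRmem n).1) aestronglyMeasurable_const hRto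
  obtain ⟨ns, -, hns⟩ := hRmeas.exists_seq_tendsto_ae
  -- (f) assemble on `B_L`
  have hall : ∀ᵐ x ∂(volume.restrict (ball (0 : EuclideanSpace ℝ (Fin 3)) L)),
      ∀ n, |P x - rieszPressure U₁ x| ≤ 4 / Real.pi * W + |R n x| := by
    rw [ae_all_iff]
    intro n
    have g1 := ae_restrict_of_ae (s := ball (0 : EuclideanSpace ℝ (Fin 3)) L) (hd2 n)
    have g2 := ae_restrict_of_ae (s := ball (0 : EuclideanSpace ℝ (Fin 3)) L) (hd1 n)
    have g3 := ae_restrict_of_ae (s := ball (0 : EuclideanSpace ℝ (Fin 3)) L) (ha n)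
    have g4 := hb n
    have g5 : ∀ᵐ x ∂(volume.restrict (ball (0 : EuclideanSpace ℝ (Fin 3)) L)),
        x ∈ ball (0 : EuclideanSpace ℝ (Fin 3)) L := ae_restrict_mem measurableSet_ball
    filter_upwards [g1, g2, g3, g4, g5] with x h1 h2 h3 h4 h5
    have hcx := hc n x h5
    rw [h1, h2, h3, h4]
    calc |rieszPressure U₁ x + (∫ y, pressureKernel (x - y) (Umid n y)) + R n x -
          rieszPressure U₁ x|
        = |(∫ y, pressureKernel (x - y) (Umid n y)) + R n x| := by ring_nf
      _ ≤ |∫ y, pressureKernel (x - y) (Umid n y)| + |R n x| := abs_add_le _ _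
      _ ≤ 4 / Real.pi * W + |R n x| := by linarith
  have hns' := ae_restrict_of_ae (s := ball (0 : EuclideanSpace ℝ (Fin 3)) L) hns
  filter_upwards [hall, hns'] with x hx hlimx
  have hlim2 : Tendsto (fun i => 4 / Real.pi * W + |R (ns i) x|) atTop (𝓝 (4 / Real.pi * W)) := by
    have := (continuous_abs.tendsto _ |>.comp hlimx).const_add (4 / Real.pi * W)
    simpa using this
  exact ge_of_tendsto hlim2 (Eventually.of_forall fun i => hx (ns i))

/-! ## Lemma 3.3: the local `L^{3/2}` bound of the pressure -/

/-- Two-term power mean: `(a + b)^r ≤ 2^{r−1}(a^r + b^r)` for `a, b ≥ 0`, `r ≥ 1` (real form of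
Mathlib's `NNReal.rpow_add_le_mul_rpow_add_rpow`). [folklore] -/
private theorem add_rpow_le_two_rpow_mul {a b r : ℝ} (ha : 0 ≤ a) (hb : 0 ≤ b) (hr : 1 ≤ r) :
    (a + b) ^ r ≤ (2 : ℝ) ^ (r - 1) * (a ^ r + b ^ r) := by
  have h := NNReal.rpow_add_le_mul_rpow_add_rpow ⟨a, ha⟩ ⟨b, hb⟩ hr
  have h' := NNReal.coe_le_coe.2 h
  simp only [NNReal.coe_rpow, NNReal.coe_mul, NNReal.coe_add, NNReal.coe_ofNat] at h'
  exact h'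

/-- `∫ |Π[U₁]|^{3/2} ≤ C_S^{3/2} ∫_{B} |U|³` for the Riesz pressure of a continuous field truncated to
a ball `B` (Stein's `L³ → L^{3/2}` bound `eLpNorm_rieszPressure_le`, in real form).
[cite: Stein1971, Ch. II §4.2 Thm. 3] -/
private theorem integral_abs_rieszPressure_indicator_rpow_le
    {U : EuclideanSpace ℝ (Fin 3) → EuclideanSpace ℝ (Fin 3)} (hUc : Continuous U) {R : ℝ} :
    ∫ x, |rieszPressure ((ball (0 : EuclideanSpace ℝ (Fin 3)) R).indicator U) x| ^ (3 / 2 : ℝ) ≤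
      (steinConstThreeHalves : ℝ) ^ (3 / 2 : ℝ) *
        ∫ y in ball (0 : EuclideanSpace ℝ (Fin 3)) R, ‖U y‖ ^ (3 : ℝ) := by
  set U₁ : EuclideanSpace ℝ (Fin 3) → EuclideanSpace ℝ (Fin 3) :=
    (ball (0 : EuclideanSpace ℝ (Fin 3)) R).indicator U with hU₁
  have hU₁3 : MemLp U₁ 3 volume :=
    memLp_setIndicator_of_continuous_isBounded hUc measurableSet_ball isBounded_ball 3
  have hPi1 := memLp_rieszPressure hU₁3
  set I : ℝ := ∫ x, |rieszPressure U₁ x| ^ (3 / 2 : ℝ) with hI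
  set J : ℝ := ∫ y in ball (0 : EuclideanSpace ℝ (Fin 3)) R, ‖U y‖ ^ (3 : ℝ) with hJ
  have hI0 : 0 ≤ I := integral_nonneg fun x => Real.rpow_nonneg (abs_nonneg _) _
  have hJ0 : 0 ≤ J := integral_nonneg fun y => Real.rpow_nonneg (norm_nonneg _) _
  have hCs : 0 ≤ (steinConstThreeHalves : ℝ) := NNReal.coe_nonneg _
  have h1 := eLpNorm_rieszPressure_le hU₁3
  rw [eLpNorm_threeHalves_eq_ofReal hPi1, hU₁,
    eLpNorm_indicator_eq_eLpNorm_restrict measurableSet_ball,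
    eLpNorm_three_restrict_eq_ofReal hUc isBounded_ball, ← hU₁, ← hI, ← hJ] at h1
  -- `I^{2/3} ≤ C_S J^{2/3}`
  have h2 : I ^ (1 / (3 / 2) : ℝ) ≤ (steinConstThreeHalves : ℝ) * (J ^ (1 / 3 : ℝ)) ^ 2 := by
    have e : (steinConstThreeHalves : ℝ≥0∞) * ENNReal.ofReal (J ^ (1 / 3 : ℝ)) ^ 2 =
        ENNReal.ofReal ((steinConstThreeHalves : ℝ) * (J ^ (1 / 3 : ℝ)) ^ 2) := by
      rw [ENNReal.ofReal_mul hCs, ENNReal.ofReal_coe_nnreal,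
        ENNReal.ofReal_pow (Real.rpow_nonneg hJ0 _)]
    rw [e] at h1
    exact (ENNReal.ofReal_le_ofReal_iff (by positivity)).1 h1
  have e23 : (J ^ (1 / 3 : ℝ)) ^ 2 = J ^ (2 / 3 : ℝ) := by
    rw [← Real.rpow_natCast, ← Real.rpow_mul hJ0]
    norm_num
  rw [e23, show (1 / (3 / 2) : ℝ) = 2 / 3 by norm_num] at h2
  -- raise to the power `3/2`
  have h3 := Real.rpow_le_rpow (Real.rpow_nonneg hI0 _) h2 (by norm_num : (0 : ℝ) ≤ 3 / 2)
  rw [← Real.rpow_mul hI0, show (2 / 3 * (3 / 2) : ℝ) = 1 by norm_num, Real.rpow_one,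
    Real.mul_rpow hCs (Real.rpow_nonneg hJ0 _), ← Real.rpow_mul hJ0,
    show (2 / 3 * (3 / 2) : ℝ) = 1 by norm_num, Real.rpow_one] at h3
  exact h3

/-- **Chae–Shvydkoy 2013, Lemma 3.3 — structural form (local `L^{3/2}` growth of the pressure).**
There are absolute constants `A, B ≥ 0` such that for every `p ≥ 3`, every `U ∈ C⁰ ∩ L^p(ℝ³)`,
every `P ∈ L^{p/2}(ℝ³)` solving the weak Poisson equation `∫ P Δφ = −∫ D²φ(U, U)`, and every
`L > 0`:
`∫_{|x|<L} |P|^{3/2} ≤ A ∫_{|y|<2L} |U|³ + B L³ (∫_{|y|≥2L} |U|²/|y|³)^{3/2}`.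
This is the printed "`∫_{|y|≤L}|q̃|^{3/2} ≤ A + B`, `A ≤ C ∫_{|z|≤2L}|v|³`,
`B ≤ L^N (Σ_k (2^{Nk}L^N)^{−1}∫_{2^kL≤|z|≤2^{k+1}L}|v|²)^{3/2}`", with the dyadic sum kept as the
integral `∫_{|y|≥2L}|U|²/|y|³`; CS13's exponent bookkeeping ("`∫|v|² ≤ CL^{a₂}`, `∫|v|³ ≤ CL^{a₃}`,
`a₂ < N`, `(3a₂−N)/2 ≤ a₃` ⇒ `∫|q|^{3/2} ≤ CL^{a₃}`") then follows by dyadic summation of the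
growth hypothesis. Near field: Stein's bound `eLpNorm_rieszPressure_le`; far field:
`ae_abs_sub_rieszPressure_indicator_le`. [cite: ChaeShvydkoy2013, §3.2.1 Lemma 3.3] -/
theorem exists_setIntegral_abs_rpow_threeHalves_le :
    ∃ A B : ℝ, 0 ≤ A ∧ 0 ≤ B ∧ ∀ {p : ℝ}, 3 ≤ p →
      ∀ {U : EuclideanSpace ℝ (Fin 3) → EuclideanSpace ℝ (Fin 3)} {P : EuclideanSpace ℝ (Fin 3) → ℝ},
        Continuous U → MemLp U (ENNReal.ofReal p) volume →
        MemLp P (ENNReal.ofReal (p / 2)) volume →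
        (∀ φ : EuclideanSpace ℝ (Fin 3) → ℝ, ContDiff ℝ (⊤ : ℕ∞) φ → HasCompactSupport φ →
          ∫ x, P x * (Δ φ) x = -∫ x, fderiv ℝ (fderiv ℝ φ) x (U x) (U x)) →
        ∀ {L : ℝ}, 0 < L →
          ∫ x in ball (0 : EuclideanSpace ℝ (Fin 3)) L, |P x| ^ (3 / 2 : ℝ) ≤
            A * (∫ y in ball (0 : EuclideanSpace ℝ (Fin 3)) (2 * L), ‖U y‖ ^ (3 : ℝ)) +
              B * L ^ 3 * (∫ y in (ball (0 : EuclideanSpace ℝ (Fin 3)) (2 * L))ᶜ,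
                ‖U y‖ ^ 2 / ‖y‖ ^ 3) ^ (3 / 2 : ℝ) := by
  set Cs : ℝ := (steinConstThreeHalves : ℝ) with hCs_def
  have hCs : 0 ≤ Cs := NNReal.coe_nonneg _
  set v₁ : ℝ := (volume : Measure (EuclideanSpace ℝ (Fin 3))).real
    (closedBall (0 : EuclideanSpace ℝ (Fin 3)) 1) with hv₁_def
  have hv₁ : 0 ≤ v₁ := measureReal_nonneg
  refine ⟨(2 : ℝ) ^ (1 / 2 : ℝ) * Cs ^ (3 / 2 : ℝ),
    (2 : ℝ) ^ (1 / 2 : ℝ) * v₁ * (4 / Real.pi) ^ (3 / 2 : ℝ), by positivity, by positivity, ?_⟩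
  intro p hp U P hUc hU hP hPoisson L hL
  have hp2 : 2 < p := by linarith
  -- the near field and the far weight
  set B₂ : Set (EuclideanSpace ℝ (Fin 3)) := ball (0 : EuclideanSpace ℝ (Fin 3)) (2 * L) with hB₂
  set U₁ : EuclideanSpace ℝ (Fin 3) → EuclideanSpace ℝ (Fin 3) := B₂.indicator U with hU₁
  set W : ℝ := ∫ y in B₂ᶜ, ‖U y‖ ^ 2 / ‖y‖ ^ 3 with hW
  have hW0 : 0 ≤ W := integral_nonneg fun y => by positivity
  have hU₁3 : MemLp U₁ 3 volume :=
    memLp_setIndicator_of_continuous_isBounded hUc measurableSet_ball isBounded_ball 3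
  have hPi1 := memLp_rieszPressure hU₁3
  set c : ℝ := (4 / Real.pi * W) ^ (3 / 2 : ℝ) with hc
  have hc0 : 0 ≤ c := Real.rpow_nonneg (by positivity) _
  -- pointwise a.e. on `B_L`: `|P|^{3/2} ≤ 2^{1/2} (|Π[U₁]|^{3/2} + c)`
  have hdec := ae_abs_sub_rieszPressure_indicator_le hp2 hUc hU hP hPoisson hL
  have hpt : ∀ᵐ x ∂(volume.restrict (ball (0 : EuclideanSpace ℝ (Fin 3)) L)),
      |P x| ^ (3 / 2 : ℝ) ≤
        (2 : ℝ) ^ (1 / 2 : ℝ) * (|rieszPressure U₁ x| ^ (3 / 2 : ℝ) + c) := by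
    filter_upwards [hdec] with x hx
    have h1 : |P x| ≤ |rieszPressure U₁ x| + 4 / Real.pi * W := by
      have := abs_sub_abs_le_abs_sub (P x) (rieszPressure U₁ x)
      linarith
    calc |P x| ^ (3 / 2 : ℝ) ≤ (|rieszPressure U₁ x| + 4 / Real.pi * W) ^ (3 / 2 : ℝ) :=
          Real.rpow_le_rpow (abs_nonneg _) h1 (by norm_num)
      _ ≤ (2 : ℝ) ^ (3 / 2 - 1 : ℝ) * (|rieszPressure U₁ x| ^ (3 / 2 : ℝ) +
            (4 / Real.pi * W) ^ (3 / 2 : ℝ)) :=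
          add_rpow_le_two_rpow_mul (abs_nonneg _) (by positivity) (by norm_num)
      _ = (2 : ℝ) ^ (1 / 2 : ℝ) * (|rieszPressure U₁ x| ^ (3 / 2 : ℝ) + c) := by
          rw [hc]
          norm_num
  -- integrability on `B_L`
  haveI : IsFiniteMeasure (volume.restrict (ball (0 : EuclideanSpace ℝ (Fin 3)) L)) :=
    isFiniteMeasure_restrict.2 measure_ball_lt_top.ne
  have hP32 : MemLp P (3 / 2) (volume.restrict (ball (0 : EuclideanSpace ℝ (Fin 3)) L)) := by
    refine (hP.restrict _).mono_exponent ?_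
    rw [show (3 / 2 : ℝ≥0∞) = ENNReal.ofReal (3 / 2) by
      rw [ENNReal.ofReal_div_of_pos two_pos]; norm_num]
    exact ENNReal.ofReal_le_ofReal (by linarith)
  have hPi : Integrable (fun x => |P x| ^ (3 / 2 : ℝ))
      (volume.restrict (ball (0 : EuclideanSpace ℝ (Fin 3)) L)) := by
    have h := hP32.integrable_norm_rpow (by norm_num) (ENNReal.div_ne_top (by norm_num) (by norm_num))
    refine h.congr (Eventually.of_forall fun x => ?_)
    simp only [Real.norm_eq_abs]
    norm_num
  have hPii : Integrable (fun x => |rieszPressure U₁ x| ^ (3 / 2 : ℝ))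
      (volume : Measure (EuclideanSpace ℝ (Fin 3))) := integrable_abs_rpow_threeHalves hPi1
  have hRi : Integrable (fun x => (2 : ℝ) ^ (1 / 2 : ℝ) * (|rieszPressure U₁ x| ^ (3 / 2 : ℝ) + c))
      (volume.restrict (ball (0 : EuclideanSpace ℝ (Fin 3)) L)) :=
    ((hPii.restrict).add (integrable_const c)).const_mul _
  -- integrate
  have hvol : (volume : Measure (EuclideanSpace ℝ (Fin 3))).real
      (ball (0 : EuclideanSpace ℝ (Fin 3)) L) ≤ v₁ * L ^ 3 := by
    calc (volume : Measure (EuclideanSpace ℝ (Fin 3))).real (ball (0 : EuclideanSpace ℝ (Fin 3)) L)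
        ≤ (volume : Measure (EuclideanSpace ℝ (Fin 3))).real
            (closedBall (0 : EuclideanSpace ℝ (Fin 3)) L) :=
          measureReal_mono ball_subset_closedBall measure_closedBall_lt_top.ne
      _ = v₁ * L ^ 3 := by
          rw [hv₁_def, Measure.addHaar_real_closedBall' volume (0 : EuclideanSpace ℝ (Fin 3)) hL.le,
            finrank_euclideanSpace_fin, mul_comm]
  have hnear := integral_abs_rieszPressure_indicator_rpow_le hUc (R := 2 * L)
  rw [← hB₂, ← hU₁] at hnear
  calc ∫ x in ball (0 : EuclideanSpace ℝ (Fin 3)) L, |P x| ^ (3 / 2 : ℝ)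
      ≤ ∫ x in ball (0 : EuclideanSpace ℝ (Fin 3)) L,
          (2 : ℝ) ^ (1 / 2 : ℝ) * (|rieszPressure U₁ x| ^ (3 / 2 : ℝ) + c) :=
        integral_mono_ae hPi hRi hpt
    _ = (2 : ℝ) ^ (1 / 2 : ℝ) * ((∫ x in ball (0 : EuclideanSpace ℝ (Fin 3)) L,
          |rieszPressure U₁ x| ^ (3 / 2 : ℝ)) +
          c * (volume : Measure (EuclideanSpace ℝ (Fin 3))).real
            (ball (0 : EuclideanSpace ℝ (Fin 3)) L)) := by
        rw [integral_const_mul, integral_add hPii.restrict (integrable_const c), integral_const,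
          smul_eq_mul, measureReal_restrict_apply_univ, mul_comm _ c]
    _ ≤ (2 : ℝ) ^ (1 / 2 : ℝ) * (Cs ^ (3 / 2 : ℝ) *
          (∫ y in B₂, ‖U y‖ ^ (3 : ℝ)) + c * (v₁ * L ^ 3)) := by
        gcongr
        · exact (setIntegral_le_integral hPii (Eventually.of_forall fun x =>
            Real.rpow_nonneg (abs_nonneg _) _)).trans hnear
    _ = (2 : ℝ) ^ (1 / 2 : ℝ) * Cs ^ (3 / 2 : ℝ) * (∫ y in B₂, ‖U y‖ ^ (3 : ℝ)) +
          (2 : ℝ) ^ (1 / 2 : ℝ) * v₁ * (4 / Real.pi) ^ (3 / 2 : ℝ) * L ^ 3 * W ^ (3 / 2 : ℝ) := by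
        rw [hc, Real.mul_rpow (by positivity) hW0]
        ring

end Literature.Analysis.FluidPDE
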